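import Summits.ResolutionOfSingularities.ResolutionOfSingularities.Theorems.HomologicalConductorNoZenoPullbackResidueField
import HarnessLib

/-!
# Crux `NoZenoR` (stmt-ResolutionOfSingularities-19943), β layer, `stub_L1wCoreF` descent brick for BC-4b hypothesis (T):
# HOW AUTOMORPHISMS OF A FACTOR ACT ON THE FIBRES OF A FIBRE PRODUCT

Route `ResolutionOfSingularities/HomologicalConductor`, crux chain W4.4.  OURS (cell res-hironaka, seat res-L0-w44-stub-2,
(L1)-PREP v4 §2 / planner (ρ48), step (T-scheme) of my 19:14Z split); AI-written, weaker than expert review; nothing here is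
a statement of the manuscript under review (Hironaka 2017).  Def-free, fact-free, `--supports 19943 --as helper`.

For a fibre product `X ×_{S'} Y` of schemes, the points over a pair `(x, y)` (with `f x = g y`) are the points of
`Spec (κ(x) ⊗_{κ(s)} κ(y))` (Mathlib `Scheme.Pullback.Triplet.SpecTensorTo`; the tree's `bijOn_specTensorTo` p542304).  Let `u`
be an endomorphism of `Y` over `S'` fixing `y`, `ū : κ(y) → κ(y)` its residue endomorphism at `y`, and `e` an endomorphism
of `X ×_{S'} Y` with `e ≫ fst = fst`, `e ≫ snd = snd ≫ u`.  Then on the fibre over `(x, y)` the map `e` acts through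
`id ⊗ ū` on `κ(x) ⊗_{κ(s)} κ(y)`:

* `exists_residueFieldMap_of_fixed` — the residue endomorphism `ū` of `u` at the fixed point `y`, with
  `Spec ū ≫ (Spec κ(y) → Y) = (Spec κ(y) → Y) ≫ u` and `κ(g y) → κ(y) → κ(y) = κ(g y) → κ(y)`;
* `exists_tensor_map` — the endomorphism `τ = id ⊗ ū` of the triplet tensor `T.tensor` (`inl ≫ τ = inl`, `inr ≫ τ = ū ≫ inr`);
* **`specTensorTo_comp_eq`** — `T.SpecTensorTo ≫ e = Spec τ ≫ T.SpecTensorTo`; pointwise `specTensorTo_apply_eq`;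
* **`exists_base_eq_of_transitive`** — consequently, if a family of such `e_i`, `τ_i` has the `τ_i` acting TRANSITIVELY on
  `Spec T.tensor`, the `e_i` act transitively on the points of `X ×_{S'} Y` over `(x, y)`.

Used for BC-4b (T): `Y = Spec Ŝ`, `y` the closed point, `u_h = Spec (ρ h)` for res-D-pv-039's `ρ : H →* (Ŝ ≃ₐ[S] Ŝ)`, `e_h`
from `…NoZenoBaseChangeAutomorphism`; the remaining input is the ring statement (T-ring) «`Aut_κ(κ̂)` is transitive on
`Spec (F ⊗_κ κ̂)`».  References (context): A. Grothendieck, EGA I (1971) §3.4–3.5 (points of fibre products) [folklore].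
-/

noncomputable section

-- single-problem summit: the doubled namespace component `ResolutionOfSingularities` is forced
set_option linter.dupNamespace false

namespace Summit.ResolutionOfSingularities.ResolutionOfSingularities.Theorems.NoZeno.ExcCount

open CategoryTheory AlgebraicGeometry Limits Scheme.Pullback

universe u

variable {X Y S' : Scheme.{u}} {f : X ⟶ S'} {g : Y ⟶ S'}

/-- **The residue endomorphism at a fixed point.**  For an endomorphism `u` of `Y` over `S'` (`u ≫ g = g`) and a point `y`
with `u y = y`, there is `ū : κ(y) → κ(y)` with `Spec ū ≫ (Spec κ(y) → Y) = (Spec κ(y) → Y) ≫ u` and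
`(κ(g y) → κ(y)) ≫ ū = (κ(g y) → κ(y))`. [folklore] -/
theorem exists_residueFieldMap_of_fixed (u : Y ⟶ Y) (hu : u ≫ g = g) {y : Y} (hy : u.base y = y) :
    ∃ ū : Y.residueField y ⟶ Y.residueField y,
      Spec.map ū ≫ Y.fromSpecResidueField y = Y.fromSpecResidueField y ≫ u ∧
        g.residueFieldMap y ≫ ū = g.residueFieldMap y := by
  refine ⟨(Y.residueFieldCongr hy).inv ≫ u.residueFieldMap y, ?_, ?_⟩
  · rw [Spec.map_comp, Category.assoc, Scheme.residueFieldCongr_inv,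
      Scheme.residueFieldCongr_fromSpecResidueField, Scheme.Hom.SpecMap_residueFieldMap_fromSpecResidueField]
  · have h1 : (u ≫ g).residueFieldMap y = g.residueFieldMap (u.base y) ≫ u.residueFieldMap y :=
      Scheme.residueFieldMap_comp u g y
    -- (stated at the point `g (u y)`, definitionally `(u ≫ g) y`, with the SAME proof as in `h3`)
    have h2 : (u ≫ g).residueFieldMap y =
        (S'.residueFieldCongr (congrArg g.base hy : g.base (u.base y) = g.base y)).hom ≫ g.residueFieldMap y :=
      Scheme.Hom.residueFieldMap_congr hu y
    have h3 : g.residueFieldMap (u.base y) ≫ (Y.residueFieldCongr hy).hom =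
        (S'.residueFieldCongr (congrArg g.base hy)).hom ≫ g.residueFieldMap y :=
      Scheme.Hom.residueFieldMap_congr' hy
    -- `g.residueFieldMap y ≫ (congr hy).inv = (congr _).inv ≫ g.residueFieldMap (u y)`
    have h4 : g.residueFieldMap y ≫ (Y.residueFieldCongr hy).inv =
        (S'.residueFieldCongr (congrArg g.base hy)).inv ≫ g.residueFieldMap (u.base y) := by
      rw [Iso.comp_inv_eq, Category.assoc, h3, Iso.inv_hom_id_assoc]
    rw [← Category.assoc, h4, Category.assoc, ← h1, h2, Iso.inv_hom_id_assoc]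

/-- **The endomorphism `id ⊗ ū` of the triplet tensor `κ(x) ⊗_{κ(s)} κ(y)`** for a `κ(s)`-compatible endomorphism `ū` of
`κ(y)` (universal property of the pushout). [folklore] -/
theorem exists_tensor_map {x : X} {y : Y} (h : f.base x = g.base y) (ū : Y.residueField y ⟶ Y.residueField y)
    (hū : g.residueFieldMap y ≫ ū = g.residueFieldMap y) :
    ∃ τ : (Triplet.mk' x y h).tensor ⟶ (Triplet.mk' x y h).tensor,
      (Triplet.mk' x y h).tensorInl ≫ τ = (Triplet.mk' x y h).tensorInl ∧
        (Triplet.mk' x y h).tensorInr ≫ τ = ū ≫ (Triplet.mk' x y h).tensorInr := by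
  set T := Triplet.mk' x y h with hT
  have w : ((S'.residueFieldCongr T.hx).inv ≫ f.residueFieldMap T.x) ≫ T.tensorInl =
      ((S'.residueFieldCongr T.hy).inv ≫ g.residueFieldMap T.y) ≫ ū ≫ T.tensorInr := by
    have hc : ((S'.residueFieldCongr T.hx).inv ≫ f.residueFieldMap T.x) ≫ T.tensorInl =
        ((S'.residueFieldCongr T.hy).inv ≫ g.residueFieldMap T.y) ≫ T.tensorInr := pushout.condition
    rw [hc, Category.assoc, Category.assoc]
    congr 1
    change g.residueFieldMap y ≫ T.tensorInr = g.residueFieldMap y ≫ ū ≫ T.tensorInr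
    rw [← Category.assoc (g.residueFieldMap y) ū, hū]
  refine ⟨pushout.desc T.tensorInl (ū ≫ T.tensorInr) w, ?_, ?_⟩
  · exact pushout.inl_desc _ _ _
  · exact pushout.inr_desc _ _ _

/-- **The induced endomorphism of `X ×_{S'} Y` acts on the fibre over `(x, y)` through `id ⊗ ū`**:
`T.SpecTensorTo ≫ e = Spec τ ≫ T.SpecTensorTo` for `e` with `e ≫ fst = fst`, `e ≫ snd = snd ≫ u`, `ū` the residue
endomorphism of `u` at the fixed point `y` and `τ = id ⊗ ū` (both sides have the same two components). [folklore] -/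
theorem specTensorTo_comp_eq (T : Triplet f g) (u : Y ⟶ Y) (e : pullback f g ⟶ pullback f g)
    (he1 : e ≫ pullback.fst f g = pullback.fst f g) (he2 : e ≫ pullback.snd f g = pullback.snd f g ≫ u)
    (ū : Y.residueField T.y ⟶ Y.residueField T.y)
    (hū : Spec.map ū ≫ Y.fromSpecResidueField T.y = Y.fromSpecResidueField T.y ≫ u)
    (τ : T.tensor ⟶ T.tensor) (hτ1 : T.tensorInl ≫ τ = T.tensorInl) (hτ2 : T.tensorInr ≫ τ = ū ≫ T.tensorInr) :
    T.SpecTensorTo ≫ e = Spec.map τ ≫ T.SpecTensorTo := by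
  apply pullback.hom_ext
  · rw [Category.assoc, he1, Triplet.specTensorTo_fst, Category.assoc, Triplet.specTensorTo_fst, ← Category.assoc,
      ← Spec.map_comp, hτ1]
  · have lhs : (T.SpecTensorTo ≫ e) ≫ pullback.snd f g =
        Spec.map T.tensorInr ≫ Spec.map ū ≫ Y.fromSpecResidueField T.y := by
      rw [Category.assoc, he2, ← Category.assoc, Triplet.specTensorTo_snd, Category.assoc, ← hū]
    have rhs : (Spec.map τ ≫ T.SpecTensorTo) ≫ pullback.snd f g =
        Spec.map T.tensorInr ≫ Spec.map ū ≫ Y.fromSpecResidueField T.y := by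
      rw [Category.assoc, Triplet.specTensorTo_snd, ← Category.assoc, ← Spec.map_comp, hτ2, Spec.map_comp,
        Category.assoc]
    rw [lhs, rhs]

/-- Pointwise form of `specTensorTo_comp_eq`. [folklore] -/
theorem specTensorTo_apply_eq (T : Triplet f g) (e : pullback f g ⟶ pullback f g) (τ : T.tensor ⟶ T.tensor)
    (hcomp : T.SpecTensorTo ≫ e = Spec.map τ ≫ T.SpecTensorTo) (p : Spec T.tensor) :
    e.base (T.SpecTensorTo.base p) = T.SpecTensorTo.base ((Spec.map τ).base p) := by
  rw [← Scheme.Hom.comp_apply, hcomp, Scheme.Hom.comp_apply]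

/-- **Transitivity on the fibre from transitivity on `Spec (κ(x) ⊗ κ(y))`**: for a family of endomorphisms `e i` of
`X ×_{S'} Y` acting on the fibre over `(x, y)` through endomorphisms `τ i` of the triplet tensor
(`T.SpecTensorTo ≫ e i = Spec (τ i) ≫ T.SpecTensorTo`), if the `Spec (τ i)` act transitively on `Spec T.tensor` then the `e i`
act transitively on the points over `(x, y)` (every such point is `T.SpecTensorTo p`, tree `exists_specTensorTo_eq`).
[folklore] -/
theorem exists_base_eq_of_transitive (T : Triplet f g) {ι : Type*} (e : ι → (pullback f g ⟶ pullback f g))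
    (τ : ι → (T.tensor ⟶ T.tensor)) (hcomp : ∀ i, T.SpecTensorTo ≫ e i = Spec.map (τ i) ≫ T.SpecTensorTo)
    (htrans : ∀ p q : Spec T.tensor, ∃ i, (Spec.map (τ i)).base p = q)
    {ζ ζ' : ↑(pullback f g)} (hζx : (pullback.fst f g).base ζ = T.x) (hζy : (pullback.snd f g).base ζ = T.y)
    (hζ'x : (pullback.fst f g).base ζ' = T.x) (hζ'y : (pullback.snd f g).base ζ' = T.y) :
    ∃ i, (e i).base ζ = ζ' := by
  obtain ⟨p, rfl⟩ := exists_specTensorTo_eq T ζ hζx hζy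
  obtain ⟨q, rfl⟩ := exists_specTensorTo_eq T ζ' hζ'x hζ'y
  obtain ⟨i, hi⟩ := htrans p q
  exact ⟨i, by rw [specTensorTo_apply_eq T (e i) (τ i) (hcomp i) p, hi]⟩

end Summit.ResolutionOfSingularities.ResolutionOfSingularities.Theorems.NoZeno.ExcCount

end
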